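import Literature.NumberTheory.EllipticCurves.Kato2004.EulerSystemValues
import Mathlib.RingTheory.Flat.Basic
import HarnessLib

set_option autoImplicit false

/-!
# AUG engine, step 7: TRANSPORT of the identities (★χ) — pull back from `ℚ_p ⊗_ℚ ℂ` to `ℚ_p ⊗_ℚ K` along an embedding
# `ι : K → ℂ` (injective: `ℚ_p` is flat over `ℚ`), push forward to any `ℚ_p`-algebra `Ω` along `j : K → Ω`
# (seat `bsd-cm-prr-ty1` g14, cell `bsd-cm`; theorems only: no definition, no named fact, no instance, no `sorry`)

Part 49 of the seat's kernel cut of stub 3 (cruxes stmt-BirchSwinnertonDyer-19945 / -19223).  E33/E35 compare two Kato families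
at a character `χ` of `Gal(ℚ_n/ℚ)` by an identity of the shape
(★) `r(u − 1)·(e • (1 ⊗ X₁)) = r′(u − 1)·(1 ⊗ (w·X₂))` in `ℚ_p ⊗_ℚ ℂ`, `u = 1 ⊗ ζ`,
whose complex ingredients `ζ = χ̄(χ_cyc γ)`, `w = χ̄(a)`, `Xᵢ = qᵢ·Pᵢ(χ,1)·𝒸⁻_χ̄(πᵢ)` all lie in the image of the cyclotomic field
`K = ℚ(ζ_{p^{n+1}})` under the frame `ι₁` (a character of `Γ_n` has values in `μ_{p^n} ⊂ K`).  The successor's separation argument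
(HOME `bsd-cm-prr-ty1/STUB3-CUT.md` §6 addendum 7) runs in `p`-adic coefficients (`MemIwasawaRat`, values in `ℂ_p`), so (★) must be
moved out of `ℚ_p ⊗_ℚ ℂ`.  THIS FILE gives the two generic moves, for any field `K` over `ℚ`:
* `map_id_injective` (+ `algHom_aeval_sub_one`) — `id ⊗ ι : ℚ_p ⊗_ℚ K → ℚ_p ⊗_ℚ L` is injective for an injective `ℚ`-algebra map `ι : K → L`
  (`Module.Flat.lTensor_preserves_injective_linearMap`; `ℚ_p` is a free, hence flat, `ℚ`-module);
* ★ `aeval_mul_eq_of_map_eq` — PULL-BACK: if (★) holds in `ℚ_p ⊗_ℚ L` for the images `ι ζ, ι w, ι X₁, ι X₂`, it holds in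
  `ℚ_p ⊗_ℚ K` for `ζ, w, X₁, X₂`;
* ★ `aeval_mul_eq_map_of_eq` — PUSH-FORWARD: if (★) holds in `ℚ_p ⊗_ℚ K` then, for every commutative `ℚ_p`-algebra `Ω` and
  `ℚ`-algebra map `j : K → Ω`, `r(j ζ − 1)·(e • j X₁) = r′(j ζ − 1)·(j w · j X₂)` in `Ω` (`a ⊗ k ↦ a • j k`,
  `Algebra.TensorProduct.lift`).
HONEST LABEL: generic algebra serving the seat's AUG engine; AUG displayed; no stub closed; nothing asserted on 19945 / 19223; BSD is
not proved for any curve.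
References: [Kato2004Asterisque] §13.9 (p. 230); [Washington1997] §13.2; N. Bourbaki, *Algèbre commutative* I §2 (flatness of free
modules) — Mathlib `Module.Flat`.
-/

noncomputable section

open scoped TensorProduct
open Polynomial

namespace Summit.BirchSwinnertonDyer.Rank1Residual.Additive.PerrinRiouUnit

variable {p : ℕ} [Fact p.Prime] {K L : Type*} [Field K] [Algebra ℚ K] [CommRing L] [Algebra ℚ L]

/-- **`id ⊗ ι : ℚ_p ⊗_ℚ K → ℚ_p ⊗_ℚ L` is injective** for an injective `ℚ`-algebra map `ι` (`ℚ_p` is flat over `ℚ`). [folklore] -/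
theorem map_id_injective (ι : K →ₐ[ℚ] L) (hι : Function.Injective ι) :
    Function.Injective (Algebra.TensorProduct.map (AlgHom.id ℚ_[p] ℚ_[p]) ι) := by
  have h := Module.Flat.lTensor_preserves_injective_linearMap (M := ℚ_[p]) ι.toLinearMap hι
  intro x y hxy
  apply h
  have key : ∀ t : ℚ_[p] ⊗[ℚ] K,
      (ι.toLinearMap.lTensor ℚ_[p]) t = Algebra.TensorProduct.map (AlgHom.id ℚ_[p] ℚ_[p]) ι t := fun t => by
    induction t using TensorProduct.induction_on with
    | zero => rw [map_zero, map_zero]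
    | tmul a k => rw [LinearMap.lTensor_tmul, Algebra.TensorProduct.map_tmul, AlgHom.id_apply, AlgHom.toLinearMap_apply]
    | add t₁ t₂ h₁ h₂ => rw [map_add, map_add, h₁, h₂]
  rw [key, key, hxy]

/-- A `ℚ_p`-algebra map commutes with `r(· − 1)` for `r ∈ ℤ_p[X]`. [folklore] -/
theorem algHom_aeval_sub_one {A B : Type*} [CommRing A] [CommRing B] [Algebra ℚ_[p] A] [Algebra ℚ_[p] B]
    [Algebra ℤ_[p] A] [Algebra ℤ_[p] B] [IsScalarTower ℤ_[p] ℚ_[p] A] [IsScalarTower ℤ_[p] ℚ_[p] B]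
    (Θ : A →ₐ[ℚ_[p]] B) (r : ℤ_[p][X]) (t : A) : Θ (aeval (t - 1) r) = aeval (Θ t - 1) r := by
  have h := Polynomial.aeval_algHom_apply (Θ.restrictScalars ℤ_[p]) (t - 1) r
  simp only [AlgHom.restrictScalars_apply, map_sub, map_one] at h
  exact h.symm

/-- ★ **PULL-BACK of (★) along `id ⊗ ι`**: an identity `r(u − 1)·(e • (1 ⊗ ι X₁)) = r′(u − 1)·(1 ⊗ (ι w · ι X₂))`,
`u = 1 ⊗ ι ζ`, in `ℚ_p ⊗_ℚ L` comes from the same identity in `ℚ_p ⊗_ℚ K` (`ι` injective, `ℚ_p` flat).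
[cite: Kato2004Asterisque, §13.9 (p. 230)] -/
theorem aeval_mul_eq_of_map_eq (ι : K →ₐ[ℚ] L) (hι : Function.Injective ι) {r r' : ℤ_[p][X]} {e : ℚ_[p]}
    {ζ w X₁ X₂ : K}
    (h : aeval (((1 : ℚ_[p]) ⊗ₜ[ℚ] ι ζ : ℚ_[p] ⊗[ℚ] L) - 1) r * (e • ((1 : ℚ_[p]) ⊗ₜ[ℚ] ι X₁ : ℚ_[p] ⊗[ℚ] L)) =
      aeval (((1 : ℚ_[p]) ⊗ₜ[ℚ] ι ζ : ℚ_[p] ⊗[ℚ] L) - 1) r' * ((1 : ℚ_[p]) ⊗ₜ[ℚ] (ι w * ι X₂))) :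
    aeval (((1 : ℚ_[p]) ⊗ₜ[ℚ] ζ : ℚ_[p] ⊗[ℚ] K) - 1) r * (e • ((1 : ℚ_[p]) ⊗ₜ[ℚ] X₁ : ℚ_[p] ⊗[ℚ] K)) =
      aeval (((1 : ℚ_[p]) ⊗ₜ[ℚ] ζ : ℚ_[p] ⊗[ℚ] K) - 1) r' * ((1 : ℚ_[p]) ⊗ₜ[ℚ] (w * X₂)) := by
  set Φ := Algebra.TensorProduct.map (AlgHom.id ℚ_[p] ℚ_[p]) ι with hΦ
  apply map_id_injective ι hι
  have h1 : Φ ((1 : ℚ_[p]) ⊗ₜ[ℚ] ζ) = (1 : ℚ_[p]) ⊗ₜ[ℚ] ι ζ := by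
    rw [hΦ, Algebra.TensorProduct.map_tmul, AlgHom.id_apply]
  have h2 : Φ (e • ((1 : ℚ_[p]) ⊗ₜ[ℚ] X₁ : ℚ_[p] ⊗[ℚ] K)) = e • ((1 : ℚ_[p]) ⊗ₜ[ℚ] ι X₁ : ℚ_[p] ⊗[ℚ] L) :=
    (map_smul Φ e _).trans (congrArg (e • ·) (by rw [hΦ, Algebra.TensorProduct.map_tmul, AlgHom.id_apply]))
  have h3 : Φ ((1 : ℚ_[p]) ⊗ₜ[ℚ] (w * X₂)) = (1 : ℚ_[p]) ⊗ₜ[ℚ] (ι w * ι X₂) := by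
    rw [hΦ, Algebra.TensorProduct.map_tmul, AlgHom.id_apply, map_mul]
  rw [map_mul, map_mul, algHom_aeval_sub_one, algHom_aeval_sub_one, h1, h2, h3]
  exact h

/-- ★ **PUSH-FORWARD of (★) to any commutative `ℚ_p`-algebra `Ω`** along a `ℚ`-algebra map `j : K → Ω`
(`a ⊗ k ↦ a • j k`): `r(j ζ − 1)·(e • j X₁) = r′(j ζ − 1)·(j w · j X₂)` in `Ω`. [cite: Kato2004Asterisque, §13.9 (p. 230)] -/
theorem aeval_mul_eq_map_of_eq {Ω : Type*} [CommRing Ω] [Algebra ℚ_[p] Ω] [Algebra ℚ Ω] [IsScalarTower ℚ ℚ_[p] Ω]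
    [Algebra ℤ_[p] Ω] [IsScalarTower ℤ_[p] ℚ_[p] Ω] (j : K →ₐ[ℚ] Ω) {r r' : ℤ_[p][X]} {e : ℚ_[p]} {ζ w X₁ X₂ : K}
    (h : aeval (((1 : ℚ_[p]) ⊗ₜ[ℚ] ζ : ℚ_[p] ⊗[ℚ] K) - 1) r * (e • ((1 : ℚ_[p]) ⊗ₜ[ℚ] X₁ : ℚ_[p] ⊗[ℚ] K)) =
      aeval (((1 : ℚ_[p]) ⊗ₜ[ℚ] ζ : ℚ_[p] ⊗[ℚ] K) - 1) r' * ((1 : ℚ_[p]) ⊗ₜ[ℚ] (w * X₂))) :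
    aeval (j ζ - 1) r * (e • j X₁) = aeval (j ζ - 1) r' * (j w * j X₂) := by
  set Ψ : ℚ_[p] ⊗[ℚ] K →ₐ[ℚ_[p]] Ω :=
    Algebra.TensorProduct.lift (Algebra.ofId ℚ_[p] Ω) j (fun x y => Commute.all _ _) with hΨ
  have hΨt : ∀ k : K, Ψ ((1 : ℚ_[p]) ⊗ₜ[ℚ] k) = j k := fun k => by
    rw [hΨ, Algebra.TensorProduct.lift_tmul, map_one, one_mul]
  have h2 : Ψ (e • ((1 : ℚ_[p]) ⊗ₜ[ℚ] X₁ : ℚ_[p] ⊗[ℚ] K)) = e • j X₁ :=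
    (map_smul Ψ e _).trans (congrArg (e • ·) (hΨt X₁))
  have key := congrArg Ψ h
  rw [map_mul, map_mul, algHom_aeval_sub_one, algHom_aeval_sub_one, hΨt, h2, hΨt, map_mul] at key
  exact key

end Summit.BirchSwinnertonDyer.Rank1Residual.Additive.PerrinRiouUnit

end
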